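/-
Copyright (c) 2026 The H21 project. Released under Apache 2.0 license.
-/
import Summits.RiemannHypothesis.RiemannHypothesis.Theorems.PfPersistenceGalerkinIndexNumber
import Summits.RiemannHypothesis.RiemannHypothesis.Theorems.PfPersistenceM2IndexFrames
import Mathlib.Analysis.Matrix.Spectrum
import HarnessLib

/-!
# `P_F` persistence — GAL-5: the INERTIA READING of the Galerkin negative index (cand-3, gen 12)

Mechanism / rigidity campaign of the `pub-rhpf` cell (variational seat M2 = cand-3); NO claim about RH is made
anywhere in this file.  Everything here is RH-free and sorry-free; no numerical datum is used (all PROVED).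
§1–§5 are PURE LINEAR ALGEBRA over `ℝ` (Sylvester's law of inertia, negative part); §6 is the dictionary to the
cell's typed objects.

For a real `m × m` matrix `M`, a NEGATIVE `n`-FRAME is a family `v₁, …, vₙ ∈ ℝ^m` on whose real span
`x ↦ xᵀ M x` is negative definite (`HasNegFrame M n`; at a window matrix this is literally the cell's
`GalerkinNegIndexAtLeast d n win`, `galerkinNegIndexAtLeast_iff_hasNegFrame`).

* §1 `HasNegFrame.le` : a negative `n`-frame has `n ≤ m` (frames are linearly independent — m2's
  `linearIndependent_of_negFrame`).
* §2 **dimension count** `HasNegFrame.add_finrank_le` : a negative `n`-frame and a subspace `E` with `xᵀ M x ≥ 0`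
  on `E` force `n + dim E ≤ m`.
* §3 `HasNegFrame.map` : frames transport along any matrix intertwining the two quadratic forms.
* §4 **SYLVESTER CERTIFICATE READING** `hasNegFrame_iff_card_neg_pivots` : if `M = L · diag D · Lᵀ` with `det L`
  a unit, then `HasNegFrame M n ↔ n ≤ #{i : D i < 0}`; hence the negative pivot count does not depend on the
  factorisation (`card_neg_pivots_eq_of_congr`, law of inertia) — a certified `LDLᵀ` sign pattern IS a statement
  about negative frames.
* §5 **EIGENVALUE READING** `hasNegFrame_iff_card_neg_eigenvalues` : for symmetric `M`,
  `HasNegFrame M n ↔ n ≤ #{i : λᵢ(M) < 0}` (Mathlib's spectral theorem supplies the congruence).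
* §6 dictionary: `galerkinNegIndex d win ≤ N + 1`; for symmetric window matrices
  `galerkinNegIndex d win = #{negative eigenvalues}` `= #{negative pivots of any LDLᵀ}`; at `ζ` (through GAL-4 and
  m2's ladder): `#{negative eigenvalues of A^{(N)}(a)} ≤ #𝒬` at every window and `⨆ = #𝒬`; RH-EQUIVALENCE reading
  (label only): `RH ↔` no truncated window matrix of `ζ`'s even block has a negative eigenvalue.
-/

set_option linter.dupNamespace false

noncomputable section

open Matrix Finset Module

namespace Summit.RiemannHypothesis.RiemannHypothesis.Theorems.PfPersistence

open Summit.RiemannHypothesis.RiemannHypothesis.Theorems.PfPersistenceM2NegIndex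
open Literature.NumberTheory.LFunctions Literature.NumberTheory.LFunctions.WeilContinuous
open Literature.NumberTheory.LFunctions.ZetaZeros

/-! ## §1 Negative frames of a real square matrix -/

/-- a NEGATIVE `n`-FRAME of the real `m × m` matrix `M`: `n` vectors on whose real span `x ↦ xᵀ M x` is negative
definite.  At a window matrix this is `GalerkinNegIndexAtLeast` (`galerkinNegIndexAtLeast_iff_hasNegFrame`).
[folklore] -/
def HasNegFrame {m : ℕ} (M : Matrix (Fin m) (Fin m) ℝ) (n : ℕ) : Prop :=
  ∃ v : Fin n → Fin m → ℝ, ∀ c : Fin n → ℝ, c ≠ 0 → (∑ i, c i • v i) ⬝ᵥ (M *ᵥ ∑ i, c i • v i) < 0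

/-- PROVED (definitional): the cell's Galerkin index notion is a negative frame of the window matrix. [folklore] -/
theorem galerkinNegIndexAtLeast_iff_hasNegFrame (d : Datum) (n : ℕ) (win : Window) :
    GalerkinNegIndexAtLeast d n win ↔ HasNegFrame (d win) n := Iff.rfl

/-- PROVED: the empty frame. [folklore] -/
theorem hasNegFrame_zero {m : ℕ} (M : Matrix (Fin m) (Fin m) ℝ) : HasNegFrame M 0 :=
  ⟨Fin.elim0, fun c hc ↦ absurd (Subsingleton.elim c 0) hc⟩

/-- PROVED: a negative frame is linearly independent (m2's `linearIndependent_of_negFrame`). [folklore] -/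
theorem linearIndependent_of_form_neg {m n : ℕ} {M : Matrix (Fin m) (Fin m) ℝ} {v : Fin n → Fin m → ℝ}
    (hv : ∀ c : Fin n → ℝ, c ≠ 0 → (∑ i, c i • v i) ⬝ᵥ (M *ᵥ ∑ i, c i • v i) < 0) : LinearIndependent ℝ v :=
  linearIndependent_of_negFrame M fun c hc ↦ by simpa only [Matrix.toBilin'_apply'] using hv c hc

/-- **PROVED: a negative `n`-frame of an `m × m` matrix has `n ≤ m`.** [folklore] -/
theorem HasNegFrame.le {m n : ℕ} {M : Matrix (Fin m) (Fin m) ℝ} (h : HasNegFrame M n) : n ≤ m := by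
  obtain ⟨v, hv⟩ := h
  simpa using (linearIndependent_of_form_neg hv).fintype_card_le_finrank

/-! ## §2 The dimension count (the engine of the law of inertia) -/

/-- **PROVED — DIMENSION COUNT.** A negative `n`-frame and a subspace `E` on which `xᵀ M x ≥ 0` force
`n + dim E ≤ m`: otherwise `(c, e) ↦ Σ cᵢ vᵢ − e` has a kernel vector, i.e. a non-trivial combination of the frame
lying in `E`. [folklore] -/
theorem HasNegFrame.add_finrank_le {m n : ℕ} {M : Matrix (Fin m) (Fin m) ℝ} (h : HasNegFrame M n)
    (E : Submodule ℝ (Fin m → ℝ)) (hE : ∀ x ∈ E, 0 ≤ x ⬝ᵥ (M *ᵥ x)) : n + finrank ℝ E ≤ m := by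
  obtain ⟨v, hv⟩ := h
  by_contra hlt
  rw [not_le] at hlt
  let T : ((Fin n → ℝ) × E) →ₗ[ℝ] (Fin m → ℝ) :=
    (Fintype.linearCombination ℝ v).comp (LinearMap.fst ℝ _ _) - E.subtype.comp (LinearMap.snd ℝ _ _)
  have hT : ∀ c : Fin n → ℝ, ∀ e : E, T (c, e) = (∑ i, c i • v i) - (e : Fin m → ℝ) := fun c e ↦ by
    simp [T, Fintype.linearCombination_apply]
  have hdim : finrank ℝ (Fin m → ℝ) < finrank ℝ ((Fin n → ℝ) × E) := by
    rw [Module.finrank_prod, Module.finrank_fin_fun, Module.finrank_fin_fun]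
    omega
  obtain ⟨⟨c, e⟩, hker, hne⟩ :=
    Submodule.exists_mem_ne_zero_of_ne_bot (LinearMap.ker_ne_bot_of_finrank_lt hdim)
  have hce : (∑ i, c i • v i) = (e : Fin m → ℝ) := by
    have h1 := LinearMap.mem_ker.1 hker
    rw [hT] at h1
    exact sub_eq_zero.1 h1
  have hc : c ≠ 0 := by
    rintro rfl
    have he : (e : Fin m → ℝ) = 0 := by rw [← hce]; simp
    have he0 : e = 0 := (Submodule.coe_eq_zero).1 he
    exact hne (by rw [he0]; rfl)
  have h1 := hv c hc
  rw [hce] at h1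
  exact absurd (hE e e.2) (not_le.2 h1)

/-! ## §3 Transport of frames along an intertwining matrix -/

/-- **PROVED — TRANSPORT.** If `Q` intertwines the quadratic forms (`xᵀ M x = (Qx)ᵀ M' (Qx)`), negative frames of
`M` push forward to negative frames of `M'`. [folklore] -/
theorem HasNegFrame.map {m m' n : ℕ} {M : Matrix (Fin m) (Fin m) ℝ} {M' : Matrix (Fin m') (Fin m') ℝ}
    (Q : Matrix (Fin m') (Fin m) ℝ) (hQ : ∀ x, x ⬝ᵥ (M *ᵥ x) = (Q *ᵥ x) ⬝ᵥ (M' *ᵥ (Q *ᵥ x)))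
    (h : HasNegFrame M n) : HasNegFrame M' n := by
  obtain ⟨v, hv⟩ := h
  refine ⟨fun i ↦ Q *ᵥ v i, fun c hc ↦ ?_⟩
  have hsum : Q *ᵥ (∑ i, c i • v i) = ∑ i, c i • (Q *ᵥ v i) := by
    rw [Matrix.mulVec_sum]
    exact Finset.sum_congr rfl fun i _ ↦ Matrix.mulVec_smul Q (c i) (v i)
  rw [← hsum, ← hQ]
  exact hv c hc

/-! ## §4 Diagonal matrices and the Sylvester certificate reading -/

/-- PROVED: the quadratic form of a diagonal matrix. [folklore] -/
theorem form_diagonal {m : ℕ} (D x : Fin m → ℝ) : x ⬝ᵥ (Matrix.diagonal D *ᵥ x) = ∑ i, D i * x i ^ 2 := by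
  simp only [dotProduct, Matrix.mulVec_diagonal]
  exact Finset.sum_congr rfl fun i _ ↦ by ring

/-- PROVED: a combination of standard basis vectors along an embedding, read at an image point. [folklore] -/
theorem sum_smul_single_apply_emb {m n : ℕ} (f : Fin n ↪ Fin m) (c : Fin n → ℝ) (j : Fin n) :
    (∑ i, c i • (Pi.single (f i) (1 : ℝ) : Fin m → ℝ)) (f j) = c j := by
  simp only [Finset.sum_apply, Pi.smul_apply, Pi.single_apply, smul_eq_mul, mul_ite, mul_one, mul_zero,
    f.injective.eq_iff]
  rw [Finset.sum_ite_eq]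
  simp

/-- PROVED: … and read off the image. [folklore] -/
theorem sum_smul_single_apply_of_not_mem {m n : ℕ} (f : Fin n ↪ Fin m) (c : Fin n → ℝ) {k : Fin m}
    (hk : ∀ j, f j ≠ k) : (∑ i, c i • (Pi.single (f i) (1 : ℝ) : Fin m → ℝ)) k = 0 := by
  simp only [Finset.sum_apply, Pi.smul_apply, Pi.single_apply, smul_eq_mul, mul_ite, mul_one, mul_zero]
  exact Finset.sum_eq_zero fun i _ ↦ if_neg fun h ↦ hk i h.symm

/-- **PROVED — DIAGONAL CASE: `HasNegFrame (diag D) n ↔ n ≤ #{i : D i < 0}`.**  `→` is the dimension count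
against `E = {x : x_i = 0 whenever D i < 0}`; `←` is the frame of standard basis vectors at negative entries.
[folklore] -/
theorem hasNegFrame_diagonal_iff {m n : ℕ} (D : Fin m → ℝ) :
    HasNegFrame (Matrix.diagonal D) n ↔ n ≤ Fintype.card {i // D i < 0} := by
  classical
  constructor
  · intro h
    let S := {i : Fin m // D i < 0}
    let π : (Fin m → ℝ) →ₗ[ℝ] (S → ℝ) := LinearMap.pi fun s : S ↦ LinearMap.proj (s : Fin m)
    have hπ : ∀ x (s : S), π x s = x s := fun x s ↦ rfl
    have hE : ∀ x ∈ LinearMap.ker π, 0 ≤ x ⬝ᵥ (Matrix.diagonal D *ᵥ x) := by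
      intro x hx
      rw [form_diagonal]
      refine Finset.sum_nonneg fun i _ ↦ ?_
      by_cases hi : D i < 0
      · have : x i = 0 := by
          have := congrFun (LinearMap.mem_ker.1 hx) ⟨i, hi⟩
          rwa [hπ] at this
        simp [this]
      · exact mul_nonneg (not_lt.1 hi) (sq_nonneg _)
    have hrank : m ≤ Fintype.card S + finrank ℝ (LinearMap.ker π) := by
      have h1 := LinearMap.finrank_range_add_finrank_ker π
      have h2 : finrank ℝ (LinearMap.range π) ≤ Fintype.card S := by
        simpa [Module.finrank_fintype_fun_eq_card] using (LinearMap.range π).finrank_le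
      rw [Module.finrank_fin_fun] at h1
      omega
    have := h.add_finrank_le (LinearMap.ker π) hE
    have hS : Fintype.card S = Fintype.card {i : Fin m // D i < 0} := rfl
    omega
  · intro hn
    obtain ⟨f⟩ : Nonempty (Fin n ↪ {i : Fin m // D i < 0}) :=
      Function.Embedding.nonempty_of_card_le (by simpa using hn)
    let g : Fin n ↪ Fin m := f.trans (Function.Embedding.subtype _)
    have hg : ∀ j, D (g j) < 0 := fun j ↦ (f j).2
    refine ⟨fun j ↦ Pi.single (g j) 1, fun c hc ↦ ?_⟩
    set x : Fin m → ℝ := ∑ i, c i • (Pi.single (g i) (1 : ℝ) : Fin m → ℝ) with hx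
    rw [form_diagonal]
    -- only the image points of `g` contribute
    have hsub : ∑ k, D k * x k ^ 2 = ∑ k ∈ Finset.univ.map g, D k * x k ^ 2 := by
      refine (Finset.sum_subset (Finset.subset_univ _) fun k _ hk ↦ ?_).symm
      have hk' : ∀ j, g j ≠ k := fun j h ↦ hk (Finset.mem_map.2 ⟨j, Finset.mem_univ _, h⟩)
      rw [hx, sum_smul_single_apply_of_not_mem g c hk']
      ring
    rw [hsub, Finset.sum_map]
    simp only [hx, sum_smul_single_apply_emb]
    obtain ⟨j, hj⟩ : ∃ j, c j ≠ 0 := by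
      by_contra hall
      exact hc (funext fun j ↦ not_not.1 fun h ↦ hall ⟨j, h⟩)
    calc ∑ i, D (g i) * c i ^ 2 < ∑ _i : Fin n, (0 : ℝ) :=
          Finset.sum_lt_sum (fun i _ ↦ mul_nonpos_iff.2 (Or.inr ⟨(hg i).le, sq_nonneg _⟩))
            ⟨j, Finset.mem_univ _, mul_neg_of_neg_of_pos (hg j) (by positivity)⟩
      _ = 0 := by simp

/-- PROVED: the quadratic form under a congruence factorisation `M = L · diag D · Lᵀ`. [folklore] -/
theorem form_congr {m : ℕ} (L : Matrix (Fin m) (Fin m) ℝ) (D x : Fin m → ℝ) :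
    x ⬝ᵥ ((L * Matrix.diagonal D * Lᵀ) *ᵥ x) = (Lᵀ *ᵥ x) ⬝ᵥ (Matrix.diagonal D *ᵥ (Lᵀ *ᵥ x)) := by
  rw [← Matrix.mulVec_mulVec, ← Matrix.mulVec_mulVec, Matrix.dotProduct_mulVec, ← Matrix.mulVec_transpose]

/-- **PROVED — SYLVESTER CERTIFICATE READING.** If `M = L · diag D · Lᵀ` with `det L` a unit (e.g. an exact or
ball-certified `LDLᵀ` with unit lower-triangular `L`), then `M` has a negative `n`-frame iff `n ≤ #{i : D i < 0}`.
[folklore] -/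
theorem hasNegFrame_iff_card_neg_pivots {m n : ℕ} {M L : Matrix (Fin m) (Fin m) ℝ} {D : Fin m → ℝ}
    (hL : IsUnit L.det) (hM : M = L * Matrix.diagonal D * Lᵀ) :
    HasNegFrame M n ↔ n ≤ Fintype.card {i // D i < 0} := by
  rw [← hasNegFrame_diagonal_iff]
  have hLt : IsUnit Lᵀ.det := by simpa [Matrix.det_transpose] using hL
  constructor
  · exact HasNegFrame.map Lᵀ fun x ↦ by rw [hM, form_congr]
  · refine HasNegFrame.map (Lᵀ)⁻¹ fun y ↦ ?_
    rw [hM, form_congr, Matrix.mulVec_mulVec, Matrix.mul_nonsing_inv _ hLt, Matrix.one_mulVec]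

/-- **PROVED — LAW OF INERTIA (negative part).** Two congruence diagonalisations of the same matrix by matrices of
unit determinant have the same number of negative pivots. [folklore] -/
theorem card_neg_pivots_eq_of_congr {m : ℕ} {M L L' : Matrix (Fin m) (Fin m) ℝ} {D D' : Fin m → ℝ}
    (hL : IsUnit L.det) (hM : M = L * Matrix.diagonal D * Lᵀ)
    (hL' : IsUnit L'.det) (hM' : M = L' * Matrix.diagonal D' * L'ᵀ) :
    Fintype.card {i // D i < 0} = Fintype.card {i // D' i < 0} :=
  le_antisymm
    ((hasNegFrame_iff_card_neg_pivots hL' hM').1 ((hasNegFrame_iff_card_neg_pivots hL hM).2 le_rfl))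
    ((hasNegFrame_iff_card_neg_pivots hL hM).1 ((hasNegFrame_iff_card_neg_pivots hL' hM').2 le_rfl))

/-! ## §5 The eigenvalue reading (symmetric matrices) -/

/-- PROVED: the real spectral theorem as a congruence factorisation `M = U · diag λ · Uᵀ` (Mathlib's
`Matrix.IsHermitian.spectral_theorem`, with `star = transpose` and `RCLike.ofReal = id` over `ℝ`). [folklore] -/
theorem IsHermitian.eq_mul_diagonal_mul_transpose {m : ℕ} {M : Matrix (Fin m) (Fin m) ℝ} (hM : M.IsHermitian) :
    M = (hM.eigenvectorUnitary : Matrix (Fin m) (Fin m) ℝ) * Matrix.diagonal hM.eigenvalues *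
      (hM.eigenvectorUnitary : Matrix (Fin m) (Fin m) ℝ)ᵀ := by
  have h := hM.spectral_theorem
  rw [Unitary.conjStarAlgAut_apply, Matrix.star_eq_conjTranspose, Matrix.conjTranspose_eq_transpose_of_trivial]
    at h
  have hd : (RCLike.ofReal ∘ hM.eigenvalues : Fin m → ℝ) = hM.eigenvalues := funext fun _ ↦ by simp
  rwa [hd] at h

/-- PROVED: the eigenvector matrix has unit determinant. [folklore] -/
theorem IsHermitian.isUnit_det_eigenvectorUnitary {m : ℕ} {M : Matrix (Fin m) (Fin m) ℝ} (hM : M.IsHermitian) :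
    IsUnit (hM.eigenvectorUnitary : Matrix (Fin m) (Fin m) ℝ).det :=
  Matrix.isUnit_det_of_left_inverse (Unitary.coe_star_mul_self hM.eigenvectorUnitary)

/-- **PROVED — EIGENVALUE READING.** A real symmetric matrix has a negative `n`-frame iff it has at least `n`
negative eigenvalues (counted with multiplicity). [folklore] -/
theorem hasNegFrame_iff_card_neg_eigenvalues {m n : ℕ} {M : Matrix (Fin m) (Fin m) ℝ} (hM : M.IsHermitian) :
    HasNegFrame M n ↔ n ≤ Fintype.card {i // hM.eigenvalues i < 0} :=
  hasNegFrame_iff_card_neg_pivots (IsHermitian.isUnit_det_eigenvectorUnitary hM)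
    (IsHermitian.eq_mul_diagonal_mul_transpose hM)

/-- PROVED: in particular some eigenvalue is negative iff some vector has negative form. [folklore] -/
theorem exists_eigenvalue_neg_iff_exists_form_neg {m : ℕ} {M : Matrix (Fin m) (Fin m) ℝ} (hM : M.IsHermitian) :
    (∃ i, hM.eigenvalues i < 0) ↔ ∃ x, x ⬝ᵥ (M *ᵥ x) < 0 := by
  have h1 : HasNegFrame M 1 ↔ ∃ x, x ⬝ᵥ (M *ᵥ x) < 0 := by
    constructor
    · rintro ⟨v, hv⟩
      exact ⟨∑ i, (fun _ ↦ (1 : ℝ)) i • v i, hv _ (by simp [funext_iff])⟩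
    · rintro ⟨x, hx⟩
      refine ⟨fun _ ↦ x, fun c hc ↦ ?_⟩
      have hc0 : c 0 ≠ 0 := fun h ↦ hc (funext fun i ↦ by rw [Subsingleton.elim i 0, h]; rfl)
      simp only [Fin.sum_univ_one, smul_dotProduct, Matrix.mulVec_smul, dotProduct_smul, smul_eq_mul]
      nlinarith [mul_pos (mul_self_pos.2 hc0) (neg_pos.2 hx)]
  rw [← h1, hasNegFrame_iff_card_neg_eigenvalues hM, Nat.succ_le_iff, Fintype.card_pos_iff, nonempty_subtype]

/-! ## §6 Dictionary: the Galerkin negative index of a window matrix -/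

/-- **PROVED: `GalerkinNegIndexAtLeast d n win → n ≤ N + 1`** (every datum). [folklore] -/
theorem GalerkinNegIndexAtLeast.le_succ {d : Datum} {n : ℕ} {win : Window} (h : GalerkinNegIndexAtLeast d n win) :
    n ≤ win.N + 1 :=
  HasNegFrame.le h

/-- **PROVED: the index number of a window matrix is at most its size `N + 1`** (every datum; in particular it is
finite). [folklore] -/
theorem galerkinNegIndex_le_succ (d : Datum) (win : Window) : galerkinNegIndex d win ≤ ((win.N + 1 : ℕ) : ℕ∞) :=
  iSup_le fun _ ↦ iSup_le fun hn ↦ by exact_mod_cast hn.le_succ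

/-- PROVED: the index number is never `⊤`. [folklore] -/
theorem galerkinNegIndex_ne_top (d : Datum) (win : Window) : galerkinNegIndex d win ≠ ⊤ :=
  ne_top_of_le_ne_top (ENat.coe_ne_top _) (galerkinNegIndex_le_succ d win)

/-- **PROVED — CERTIFICATE READING at a window:** if the window matrix factors as `L · diag D · Lᵀ` with `det L`
a unit, then `GalerkinNegIndexAtLeast d n win ↔ n ≤ #{i : D i < 0}`. [folklore] -/
theorem galerkinNegIndexAtLeast_iff_le_card_neg_pivots {d : Datum} {n : ℕ} {win : Window}
    {L : Matrix (Fin (win.N + 1)) (Fin (win.N + 1)) ℝ} {D : Fin (win.N + 1) → ℝ}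
    (hL : IsUnit L.det) (h : d win = L * Matrix.diagonal D * Lᵀ) :
    GalerkinNegIndexAtLeast d n win ↔ n ≤ Fintype.card {i // D i < 0} :=
  hasNegFrame_iff_card_neg_pivots hL h

/-- **PROVED — EIGENVALUE READING at a window** (symmetric window matrix):
`GalerkinNegIndexAtLeast d n win ↔ n ≤ #{negative eigenvalues of d win}`. [folklore] -/
theorem galerkinNegIndexAtLeast_iff_le_card_neg_eigenvalues {d : Datum} {n : ℕ} {win : Window}
    (hd : (d win).IsHermitian) :
    GalerkinNegIndexAtLeast d n win ↔ n ≤ Fintype.card {i // hd.eigenvalues i < 0} :=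
  hasNegFrame_iff_card_neg_eigenvalues hd

/-- PROVED: an `ℕ∞`-valued quantity whose lower integer bounds are exactly `n ≤ k` equals `k`. [folklore] -/
theorem enat_eq_natCast_of_forall_iff {x : ℕ∞} {k : ℕ} (h : ∀ n : ℕ, (n : ℕ∞) ≤ x ↔ n ≤ k) : x = k := by
  refine le_antisymm ?_ (by exact_mod_cast (h k).2 le_rfl)
  rcases eq_or_ne x ⊤ with hx | hx
  · exact absurd ((h (k + 1)).1 (hx ▸ le_top)) (by omega)
  · lift x to ℕ using hx
    exact_mod_cast (h x).1 le_rfl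

/-- **PROVED: `galerkinNegIndex d win = #{negative eigenvalues of d win}`** (symmetric window matrix). [folklore] -/
theorem galerkinNegIndex_eq_card_neg_eigenvalues {d : Datum} {win : Window} (hd : (d win).IsHermitian) :
    galerkinNegIndex d win = (Fintype.card {i // hd.eigenvalues i < 0} : ℕ∞) :=
  enat_eq_natCast_of_forall_iff fun _ ↦
    natCast_le_galerkinNegIndex_iff.trans (galerkinNegIndexAtLeast_iff_le_card_neg_eigenvalues hd)

/-- **PROVED: `galerkinNegIndex d win = #{negative pivots}`** of any unit-determinant congruence diagonalisation of
the window matrix. [folklore] -/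
theorem galerkinNegIndex_eq_card_neg_pivots {d : Datum} {win : Window}
    {L : Matrix (Fin (win.N + 1)) (Fin (win.N + 1)) ℝ} {D : Fin (win.N + 1) → ℝ}
    (hL : IsUnit L.det) (h : d win = L * Matrix.diagonal D * Lᵀ) :
    galerkinNegIndex d win = (Fintype.card {i // D i < 0} : ℕ∞) :=
  enat_eq_natCast_of_forall_iff fun _ ↦
    natCast_le_galerkinNegIndex_iff.trans (galerkinNegIndexAtLeast_iff_le_card_neg_pivots hL h)

/-- PROVED: `ε₁(d win) < 0 ↔` the (symmetric) window matrix has a negative eigenvalue. [folklore] -/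
theorem bottomRayleigh_neg_iff_exists_eigenvalue_neg {d : Datum} {win : Window} (hd : (d win).IsHermitian) :
    bottomRayleigh (d win) < 0 ↔ ∃ i, hd.eigenvalues i < 0 := by
  rw [← galerkinNegIndexAtLeast_one_iff, galerkinNegIndexAtLeast_iff_le_card_neg_eigenvalues hd,
    Nat.succ_le_iff, Fintype.card_pos_iff, nonempty_subtype]

/-- PROVED: `WindowPositive (d win) ↔` the (symmetric) window matrix has no negative eigenvalue. [folklore] -/
theorem windowPositive_iff_forall_eigenvalue_nonneg {d : Datum} {win : Window} (hd : (d win).IsHermitian) :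
    WindowPositive (d win) ↔ ∀ i, 0 ≤ hd.eigenvalues i := by
  rw [← not_galerkinNegIndexAtLeast_one_iff_windowPositive, galerkinNegIndexAtLeast_one_iff,
    bottomRayleigh_neg_iff_exists_eigenvalue_neg hd]
  simp

/-! ### At `ζ` -/

/-- PROVED: the truncated even block of `ζ` is a real symmetric (= Hermitian) matrix. [folklore] -/
theorem zetaDatum_isHermitian (win : Window) : (zetaDatum win).IsHermitian :=
  Matrix.isHermitian_iff_isSymm.2 (zetaDatum_isSymm win)

/-- **PROVED — UNCONDITIONAL: at every window, the number of negative eigenvalues of the truncated even block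
`A^{(N)}(a)` of `ζ` is at most the number `#𝒬` of off-line zero quadruples** (inertia reading + GAL-4 + m2's ladder).
RH-free. [folklore] -/
theorem zeta_card_neg_eigenvalues_le_encard (win : Window) :
    (Fintype.card {i // (zetaDatum_isHermitian win).eigenvalues i < 0} : ℕ∞) ≤
      {ρ : ℂ | ρ ∈ riemannZetaNontrivialZeros ∧ 1 / 2 < ρ.re ∧ 0 < ρ.im}.encard := by
  rw [← galerkinNegIndex_eq_card_neg_eigenvalues]
  exact galerkinNegIndex_le_encard win

/-- **PROVED — `⨆_{(a,N)} #{negative eigenvalues of A^{(N)}(a)} = #𝒬`** (in `ℕ ∪ {⊤}`; unconditional, RH-free).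
[folklore] -/
theorem iSup_zeta_card_neg_eigenvalues_eq_encard :
    (⨆ win : Window, (Fintype.card {i // (zetaDatum_isHermitian win).eigenvalues i < 0} : ℕ∞)) =
      {ρ : ℂ | ρ ∈ riemannZetaNontrivialZeros ∧ 1 / 2 < ρ.re ∧ 0 < ρ.im}.encard := by
  rw [← iSup_galerkinNegIndex_eq_encard]
  exact iSup_congr fun win ↦ (galerkinNegIndex_eq_card_neg_eigenvalues (zetaDatum_isHermitian win)).symm

/-- **PROVED — AT FIXED HALF-LENGTH: `⨆_N #{negative eigenvalues of A^{(N)}(a)} = ind⁻_ev(a)`** (m2's continuum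
window index). RH-free. [folklore] -/
theorem iSup_zeta_card_neg_eigenvalues_eq_evenNegIndex {a : ℝ} (ha : 0 < a) :
    (⨆ N : ℕ, (Fintype.card {i // (zetaDatum_isHermitian ⟨a, N, ha⟩).eigenvalues i < 0} : ℕ∞)) =
      ⨆ n : ℕ, ⨆ _ : EvenNegIndexAtLeast n a, (n : ℕ∞) := by
  rw [← iSup_galerkinNegIndex_eq_evenNegIndex ha]
  exact iSup_congr fun N ↦ (galerkinNegIndex_eq_card_neg_eigenvalues (zetaDatum_isHermitian ⟨a, N, ha⟩)).symm

/-- PROVED: the negative eigenvalue count of `ζ`'s truncations is non-decreasing in `N` (nesting). [folklore] -/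
theorem zeta_card_neg_eigenvalues_mono {a : ℝ} {ha : 0 < a} {N N' : ℕ} (hNN' : N ≤ N') :
    Fintype.card {i // (zetaDatum_isHermitian ⟨a, N, ha⟩).eigenvalues i < 0} ≤
      Fintype.card {i // (zetaDatum_isHermitian ⟨a, N', ha⟩).eigenvalues i < 0} := by
  have h := zeta_galerkinNegIndex_mono (a := a) (ha := ha) hNN'
  rw [galerkinNegIndex_eq_card_neg_eigenvalues (zetaDatum_isHermitian _),
    galerkinNegIndex_eq_card_neg_eigenvalues (zetaDatum_isHermitian _)] at h
  exact_mod_cast h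

/-- RH-EQUIVALENCE (no RH claim): `RH ↔` no truncated window matrix of `ζ`'s even block has a negative eigenvalue
(= the tree's `AllWindowsPositive ζ ↔ RH` read through the inertia dictionary; nothing new about RH). [folklore] -/
theorem riemannHypothesis_iff_forall_eigenvalues_nonneg :
    RiemannHypothesis ↔ ∀ win : Window, ∀ i, 0 ≤ (zetaDatum_isHermitian win).eigenvalues i := by
  rw [riemannHypothesis_iff_forall_galerkinNegIndex_eq_zero]
  refine forall_congr' fun win ↦ ?_
  rw [galerkinNegIndex_eq_zero_iff, windowPositive_iff_forall_eigenvalue_nonneg]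

end Summit.RiemannHypothesis.RiemannHypothesis.Theorems.PfPersistence
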